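import Literature.Topology.FourManifolds.GaussDiagramsChart
import Literature.Topology.FourManifolds.GaussDiagramsPerturbation
import Literature.Topology.FourManifolds.LeeRasmussenProofs
import Literature.Topology.FourManifolds.LeeRasmussenFlipProofs
import HarnessLib

/-!
# Transport of regular projections: change of base point, translations of the chart, turning over

Topic `Literature/Topology/FourManifolds`; a brick of the realisation of connected sums of knot
diagrams (`ConnSumRealisation`, serving the unconditional existential additivity of Rasmussen's
`s` and the named fact `HasRasmussenInvariant.eq_of_isConcordant` of `Rasmussen.lean`). A regular
projection `P : K.RegularProjection` (`GaussDiagrams.lean`: the knot read through the stereographic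
chart `(planarProjection, height)` from the north pole, with the parameters of its `2n` passages
through crossings and the Gauss diagram read off) is transported along three elementary
operations, all of which keep the plane curve up to a symmetry of the chart:

* **change of base point** (`Knot.RegularProjection.rotate`): listing the same passages from `j`
  steps earlier reads the rotated diagram `P.diagram.rotate j` (`GaussDiagram.rotate`, GPV (2000),
  §1.2: based versus unbased Gauss diagrams); and **every arc can be made the base arc**
  (`exists_rotate_forall_mem_Ioo`): for a parameter `t₀` which is not a passage through a crossing
  there is a rotation all of whose passage parameters lie in one window `(T - 2π, T)` with
  `T ≡ t₀ (mod 2π)`, so that the arc through `t₀` carries the base point;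
* **translations of the chart** (`Knot.RegularProjection.translate`): a knot whose chart curve
  (`Knot.stereoCurve`, `GaussDiagramsChart.lean`) is a translate `c + v` of that of `K` reads the
  same diagram with the same parameters (plane curve translated, heights shifted, velocities kept);
* **turning over** (`Knot.RegularProjection.flip`): a knot whose chart curve is
  `((a, -y), -h)` where `((a, y), h)` is that of `K` — the knot rotated by `π` about the first axis
  of the projection plane — reads the flipped diagram `P.diagram.flip`
  (`LeeRasmussenFlipProofs.lean`: arrows reversed, signs kept) with the same parameters: heights are
  negated, so over- and under-passages are exchanged, and the sign
  `sign det (γ'(over), γ'(under))` is kept, the reflection of the plane and the exchange of the two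
  rows each negating the determinant.

Consequences for `Knot.HasGaussDiagram` and for Rasmussen's invariant of the diagrams read
(`rasmussenInvariant_rotate`, `rasmussenInvariant_flip`) are recorded at the end. Everything here
is proved; no named facts are introduced.

## References

* M. Goussarov, M. Polyak, O. Viro, *Finite-type invariants of classical and virtual knots*,
  Topology 39 (2000), §1.2 (based Gauss diagrams; change of base point), §1.4 (symmetries).
  [GPV2000]
* D. Rolfsen, *Knots and Links* (1976), §3.E (regular projections). [Rolfsen1976]
* K. Reidemeister, *Knotentheorie* (1932), Kap. I §1. [Reidemeister1932]

## Design notes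

No statement of another file is modified; no `sorry`; no definitions of `Prop` type. The
rotated / translated / flipped projections are concrete structures (`def`s with bodies) whose
`diagram` fields are the rotated / same / flipped diagrams *definitionally*. `𝔼 n`, `𝕊 n` are
local notation as in `Knots.lean`.
-/

open scoped Manifold ContDiff Topology Real
open Function Set

noncomputable section

namespace Literature.Topology.FourManifolds

/-- Local notation: `𝔼 n` is the model Euclidean space `EuclideanSpace ℝ (Fin n)`. -/
local notation "𝔼 " n:arg => EuclideanSpace ℝ (Fin n)

/-- Local notation: `𝕊 n` is the unit sphere in `EuclideanSpace ℝ (Fin (n + 1))`. -/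
local notation "𝕊 " n:arg => (Metric.sphere (0 : EuclideanSpace ℝ (Fin (n + 1))) 1)

namespace Knot

namespace RegularProjection

variable {K : Knot} (P : K.RegularProjection)

/-! ### Periodicity of the data read by a regular projection -/

/-- The plane curve takes the same value at parameters differing by `2π`. [folklore] -/
theorem planeCurve_sub_two_pi (t : ℝ) : K.planeCurve (t - 2 * π) = K.planeCurve t :=
  K.periodic_planeCurve.sub_eq t

/-- The height function takes the same value at parameters differing by `2π`. [folklore] -/
theorem heightCurve_sub_two_pi (t : ℝ) : K.heightCurve (t - 2 * π) = K.heightCurve t :=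
  K.periodic_heightCurve.sub_eq t

/-- The velocity of the plane curve takes the same value at parameters differing by `2π`.
[folklore] -/
theorem deriv_planeCurve_sub_two_pi (t : ℝ) :
    deriv K.planeCurve (t - 2 * π) = deriv K.planeCurve t :=
  (periodic_deriv_of_periodic K.periodic_planeCurve).sub_eq t

/-- The plane curve at a parameter shifted by `-2π` or not. [folklore] -/
theorem planeCurve_sub_ite (t : ℝ) (c : Prop) [Decidable c] :
    K.planeCurve (t - if c then 2 * π else 0) = K.planeCurve t := by
  split_ifs
  · exact planeCurve_sub_two_pi t
  · rw [sub_zero]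

/-- The height function at a parameter shifted by `-2π` or not. [folklore] -/
theorem heightCurve_sub_ite (t : ℝ) (c : Prop) [Decidable c] :
    K.heightCurve (t - if c then 2 * π else 0) = K.heightCurve t := by
  split_ifs
  · exact heightCurve_sub_two_pi t
  · rw [sub_zero]

/-- The velocity of the plane curve at a parameter shifted by `-2π` or not. [folklore] -/
theorem deriv_planeCurve_sub_ite (t : ℝ) (c : Prop) [Decidable c] :
    deriv K.planeCurve (t - if c then 2 * π else 0) = deriv K.planeCurve t := by
  split_ifs
  · exact deriv_planeCurve_sub_two_pi t
  · rw [sub_zero]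

/-! ### Change of base point -/

section Rotate

variable (j : ℕ)

/-- **The parameters after a change of base point**: the passage listed at the new position
`q = p + j (mod 2n)` is the old passage `p`, at the old parameter lowered by `2π` if the position
wrapped around (so that the new list is again increasing within one period). GPV (2000), §1.2.
[cite: GPV2000, §1.2] -/
def rotateθ (q : Fin (2 * P.diagram.n)) : ℝ :=
  P.θ ((P.diagram.rotPos j).symm q) - if (q : ℕ) < j then 2 * π else 0

variable (hj : j ≤ 2 * P.diagram.n)
include hj

/-- The rotated position of `p` wraps around (`(p + j) mod 2n < j`) iff `2n ≤ p + j` (for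
`j ≤ 2n`). [folklore] -/
theorem val_rotPos_lt_iff (p : Fin (2 * P.diagram.n)) :
    (P.diagram.rotPos j p : ℕ) < j ↔ 2 * P.diagram.n ≤ p + j := by
  rw [GaussDiagram.val_rotPos]
  have hp := p.isLt
  by_cases h : p + j < 2 * P.diagram.n
  · rw [Nat.mod_eq_of_lt h]; omega
  · push Not at h
    rw [Nat.mod_eq_sub_mod h, Nat.mod_eq_of_lt (by omega)]
    omega

/-- The value of the rotated position of `p`: `p + j` or `p + j - 2n` (for `j ≤ 2n`). [folklore] -/
theorem val_rotPos_eq (p : Fin (2 * P.diagram.n)) :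
    (P.diagram.rotPos j p : ℕ) = if 2 * P.diagram.n ≤ p + j then p + j - 2 * P.diagram.n else p + j := by
  rw [GaussDiagram.val_rotPos]
  have hp := p.isLt
  split_ifs with h
  · rw [Nat.mod_eq_sub_mod h, Nat.mod_eq_of_lt (by omega)]
  · rw [Nat.mod_eq_of_lt (by omega)]

/-- The new parameter at the rotated position of `p`. [folklore] -/
theorem rotateθ_rotPos (p : Fin (2 * P.diagram.n)) :
    P.rotateθ j (P.diagram.rotPos j p) =
      P.θ p - if 2 * P.diagram.n ≤ (p : ℕ) + j then 2 * π else 0 := by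
  unfold rotateθ
  rw [Equiv.symm_apply_apply]
  congr 1
  exact if_congr (P.val_rotPos_lt_iff j hj p) rfl rfl

/-- The new parameters increase with the new position. [folklore] -/
theorem strictMono_rotateθ : StrictMono (P.rotateθ j) := by
  intro q₁ q₂ hq
  obtain ⟨p₁, rfl⟩ := (P.diagram.rotPos j).surjective q₁
  obtain ⟨p₂, rfl⟩ := (P.diagram.rotPos j).surjective q₂
  rw [P.rotateθ_rotPos j hj, P.rotateθ_rotPos j hj]
  have hv := Fin.lt_def.1 hq
  rw [P.val_rotPos_eq j hj p₁, P.val_rotPos_eq j hj p₂] at hv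
  have h1 := p₁.isLt
  have h2 := p₂.isLt
  have hmono := P.strictMono
  split_ifs at hv ⊢ with c₁ c₂ c₂
  · -- both wrapped
    have : p₁ < p₂ := Fin.lt_def.2 (by omega)
    linarith [hmono this]
  · -- `p₁` wrapped, `p₂` not: a full turn apart
    linarith [P.lt_add_two_pi p₁ p₂]
  · -- `p₁` not wrapped, `p₂` wrapped: impossible
    omega
  · have : p₁ < p₂ := Fin.lt_def.2 (by omega)
    linarith [hmono this]

/-- The new parameters lie in one period. [folklore] -/
theorem rotateθ_lt_add_two_pi (q₁ q₂ : Fin (2 * P.diagram.n)) :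
    P.rotateθ j q₁ < P.rotateθ j q₂ + 2 * π := by
  obtain ⟨p₁, rfl⟩ := (P.diagram.rotPos j).surjective q₁
  obtain ⟨p₂, rfl⟩ := (P.diagram.rotPos j).surjective q₂
  rw [P.rotateθ_rotPos j hj, P.rotateθ_rotPos j hj]
  have h1 := p₁.isLt
  have h2 := p₂.isLt
  have hmono := P.strictMono
  have hπ : 0 < 2 * π := by positivity
  split_ifs with c₁ c₂ c₂
  · linarith [P.lt_add_two_pi p₁ p₂]
  · linarith [P.lt_add_two_pi p₁ p₂]
  · -- `p₁` not wrapped, `p₂` wrapped: `p₁ < p₂`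
    have : p₁ < p₂ := Fin.lt_def.2 (by omega)
    linarith [hmono this]
  · linarith [P.lt_add_two_pi p₁ p₂]

/-- The new parameter at the over-passage of chord `i` of the rotated diagram. [folklore] -/
theorem rotateθ_overPos (i : Fin P.diagram.n) :
    P.rotateθ j ((P.diagram.rotate j).overPos i) =
      P.θ (P.diagram.overPos i) -
        if 2 * P.diagram.n ≤ (P.diagram.overPos i : ℕ) + j then 2 * π else 0 := by
  rw [GaussDiagram.rotate_overPos, P.rotateθ_rotPos j hj]

/-- The new parameter at the under-passage of chord `i` of the rotated diagram. [folklore] -/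
theorem rotateθ_underPos (i : Fin P.diagram.n) :
    P.rotateθ j ((P.diagram.rotate j).underPos i) =
      P.θ (P.diagram.underPos i) -
        if 2 * P.diagram.n ≤ (P.diagram.underPos i : ℕ) + j then 2 * π else 0 := by
  rw [GaussDiagram.rotate_underPos, P.rotateθ_rotPos j hj]

/-- **Change of base point of a regular projection.** The same regular projection of `K`, its
`2n` passages through crossings listed from `j ≤ 2n` steps earlier (new position of the old
position `p` is `p + j mod 2n`; the wrapped parameters are lowered by `2π`), reads the rotated
Gauss diagram `P.diagram.rotate j`. All clauses are those of `P` read at parameters shifted by a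
multiple of the period. GPV (2000), §1.2 (a based Gauss diagram depends on the base point only up
to rotation). [cite: GPV2000, §1.2] -/
def rotate : K.RegularProjection where
  diagram := P.diagram.rotate j
  θ := P.rotateθ j
  strictMono := P.strictMono_rotateθ j hj
  lt_add_two_pi := P.rotateθ_lt_add_two_pi j hj
  northPole_notMem := P.northPole_notMem
  deriv_ne_zero := P.deriv_ne_zero
  double i := by
    show K.planeCurve (P.rotateθ j ((P.diagram.rotate j).overPos i)) =
      K.planeCurve (P.rotateθ j ((P.diagram.rotate j).underPos i))
    rw [P.rotateθ_overPos j hj, P.rotateθ_underPos j hj, planeCurve_sub_ite, planeCurve_sub_ite]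
    exact P.double i
  eq_or_crossing s t hst := by
    rcases P.eq_or_crossing s t hst with h | ⟨i, k, l, h⟩
    · exact .inl h
    · refine .inr ⟨i, ?_⟩
      show ∃ k l : ℤ, ({s + k * (2 * π), t + l * (2 * π)} : Set ℝ) =
        {P.rotateθ j ((P.diagram.rotate j).overPos i), P.rotateθ j ((P.diagram.rotate j).underPos i)}
      rw [P.rotateθ_overPos j hj, P.rotateθ_underPos j hj]
      -- the shifts at the two ends, as integers
      set so : ℤ := if 2 * P.diagram.n ≤ (P.diagram.overPos i : ℕ) + j then 1 else 0 with hso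
      set su : ℤ := if 2 * P.diagram.n ≤ (P.diagram.underPos i : ℕ) + j then 1 else 0 with hsu
      have eo : (if 2 * P.diagram.n ≤ (P.diagram.overPos i : ℕ) + j then 2 * π else 0) = so * (2 * π) := by
        rw [hso]; split_ifs <;> simp
      have eu : (if 2 * P.diagram.n ≤ (P.diagram.underPos i : ℕ) + j then 2 * π else 0) = su * (2 * π) := by
        rw [hsu]; split_ifs <;> simp
      rw [eo, eu]
      rw [pair_eq_pair_iff] at h
      rcases h with ⟨h1, h2⟩ | ⟨h1, h2⟩
      · refine ⟨k - so, l - su, ?_⟩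
        rw [pair_eq_pair_iff]
        refine .inl ⟨?_, ?_⟩ <;> push_cast <;> linarith
      · refine ⟨k - su, l - so, ?_⟩
        rw [pair_eq_pair_iff]
        refine .inr ⟨?_, ?_⟩ <;> push_cast <;> linarith
  heightCurve_lt i := by
    show K.heightCurve (P.rotateθ j ((P.diagram.rotate j).underPos i)) <
      K.heightCurve (P.rotateθ j ((P.diagram.rotate j).overPos i))
    rw [P.rotateθ_overPos j hj, P.rotateθ_underPos j hj, heightCurve_sub_ite, heightCurve_sub_ite]
    exact P.heightCurve_lt i
  sign_eq i := by
    show (((P.diagram.rotate j).sign i : ℤˣ) : ℤ) = SignType.sign (Matrix.det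
      !![(deriv K.planeCurve (P.rotateθ j ((P.diagram.rotate j).overPos i))).1,
          (deriv K.planeCurve (P.rotateθ j ((P.diagram.rotate j).overPos i))).2;
         (deriv K.planeCurve (P.rotateθ j ((P.diagram.rotate j).underPos i))).1,
          (deriv K.planeCurve (P.rotateθ j ((P.diagram.rotate j).underPos i))).2])
    rw [P.rotateθ_overPos j hj, P.rotateθ_underPos j hj, deriv_planeCurve_sub_ite,
      deriv_planeCurve_sub_ite, GaussDiagram.rotate_sign]
    exact P.sign_eq i

/-- The rotated projection reads the rotated diagram. [folklore] -/
@[simp] theorem rotate_diagram : (P.rotate j hj).diagram = P.diagram.rotate j := rfl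

/-- The parameters of the rotated projection. [folklore] -/
@[simp] theorem rotate_θ : (P.rotate j hj).θ = P.rotateθ j := rfl

end Rotate

/-! ### Every arc can be made the base arc -/

/-- **The set of positions whose parameter exceeds a given value is a final segment.** If
`θ 0 < t₁` then, `j` denoting the number of positions `p` with `t₁ < θ p`, one has
`t₁ < θ p ↔ 2n - j ≤ p` (the parameters increase with the position). [folklore] -/
theorem lt_θ_iff_le_val {t₁ : ℝ} (p : Fin (2 * P.diagram.n)) :
    t₁ < P.θ p ↔
      2 * P.diagram.n - (Finset.univ.filter fun p : Fin (2 * P.diagram.n) ↦ t₁ < P.θ p).card ≤ (p : ℕ) := by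
  classical
  set U := Finset.univ.filter fun p : Fin (2 * P.diagram.n) ↦ t₁ < P.θ p with hU
  have hmono := P.strictMono
  constructor
  · intro hp
    -- every position after `p` is in `U`
    have hsub : Finset.Ici p ⊆ U := fun q hq ↦ by
      rw [Finset.mem_Ici] at hq
      rw [hU, Finset.mem_filter]
      exact ⟨Finset.mem_univ _, hp.trans_le (hmono.monotone hq)⟩
    have := Finset.card_le_card hsub
    rw [Fin.card_Ici] at this
    omega
  · intro hp
    by_contra hlt
    -- no position up to `p` is in `U`
    have hsub : U ⊆ Finset.Ioi p := fun q hq ↦ by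
      rw [hU, Finset.mem_filter] at hq
      rw [Finset.mem_Ioi]
      by_contra hqp
      exact hlt (hq.2.trans_le (hmono.monotone (not_lt.1 hqp)))
    have := Finset.card_le_card hsub
    rw [Fin.card_Ioi] at this
    have hp' := p.isLt
    omega

/-- **Every arc can be made the base arc.** If `t₀` is not (modulo `2π`) a parameter of a passage
through a crossing, then for some rotation `P.rotate j` of the base point all `2n` passage
parameters lie in one window `(T - 2π, T)` with `T ≡ t₀ (mod 2π)`: the base point of the rotated
projection sits on the arc through `t₀`. (Take `T ≡ t₀` in `(θ 0, θ 0 + 2π)` and `j` the number of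
passages after `T`.) GPV (2000), §1.2. [cite: GPV2000, §1.2] -/
theorem exists_rotate_forall_mem_Ioo {t₀ : ℝ} (ht₀ : ∀ p (m : ℤ), P.θ p ≠ t₀ + m * (2 * π)) :
    ∃ (j : ℕ) (hj : j ≤ 2 * P.diagram.n) (m : ℤ),
      ∀ q, (P.rotate j hj).θ q ∈ Ioo (t₀ + m * (2 * π) - 2 * π) (t₀ + m * (2 * π)) := by
  classical
  by_cases hn : 2 * P.diagram.n = 0
  · refine ⟨0, Nat.zero_le _, 0, fun q ↦ ?_⟩
    have h := q.isLt
    change (q : ℕ) < 2 * P.diagram.n at h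
    omega
  -- the representative of `t₀` just after `θ 0`
  have hπ : (0 : ℝ) < 2 * π := by positivity
  set p0 : Fin (2 * P.diagram.n) := ⟨0, Nat.pos_of_ne_zero hn⟩ with hp0
  obtain ⟨m, hm⟩ : ∃ m : ℤ, t₀ + m * (2 * π) ∈ Ioc (P.θ p0) (P.θ p0 + 2 * π) := by
    refine ⟨toIocDiv hπ (P.θ p0) t₀ * (-1), ?_⟩
    have h := toIocMod_mem_Ioc hπ (P.θ p0) t₀
    rw [toIocMod] at h
    push_cast
    convert h using 1
    rw [zsmul_eq_mul]; ring
  set t₁ := t₀ + m * (2 * π) with ht₁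
  have ht₁lt : t₁ < P.θ p0 + 2 * π := by
    rcases hm.2.lt_or_eq with h | h
    · exact h
    · exact (ht₀ p0 (m - 1) (by rw [ht₁] at h; push_cast; linarith)).elim
  set j := (Finset.univ.filter fun p : Fin (2 * P.diagram.n) ↦ t₁ < P.θ p).card with hjdef
  have hj : j ≤ 2 * P.diagram.n := by
    rw [hjdef]
    exact (Finset.card_filter_le _ _).trans (by simp)
  refine ⟨j, hj, m, fun q ↦ ?_⟩
  rw [← ht₁]
  obtain ⟨p, rfl⟩ := (P.diagram.rotPos j).surjective q
  rw [rotate_θ, P.rotateθ_rotPos j hj]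
  have hiff := P.lt_θ_iff_le_val (t₁ := t₁) p
  rw [← hjdef] at hiff
  have hp := p.isLt
  have h0p : P.θ p0 ≤ P.θ p := P.strictMono.monotone (Fin.le_def.2 (Nat.zero_le _))
  have hne : P.θ p ≠ t₁ := ht₀ p m
  split_ifs with c
  · -- wrapped: `t₁ < θ p < θ 0 + 2π ≤ t₁ + 2π`
    have h1 : t₁ < P.θ p := hiff.2 (by omega)
    have h2 := P.lt_add_two_pi p p0
    constructor <;> linarith [hm.1]
  · -- not wrapped: `t₁ - 2π < θ 0 ≤ θ p < t₁`
    have h1 : ¬ t₁ < P.θ p := fun h ↦ by have := hiff.1 h; omega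
    push Not at h1
    rw [sub_zero]
    exact ⟨by linarith, lt_of_le_of_ne h1 hne⟩

/-! ### Translations of the chart -/

section Translate

variable {K' : Knot} {v : (ℝ × ℝ) × ℝ}

/-- The plane curve of a chart-translate is the translated plane curve. [folklore] -/
theorem planeCurve_of_stereoCurve_add (hv : K'.stereoCurve = fun t ↦ K.stereoCurve t + v) (t : ℝ) :
    K'.planeCurve t = K.planeCurve t + v.1 := by
  have := congrFun hv t
  rw [Knot.planeCurve_eq_fst_comp, Function.comp_apply, this]
  rfl

/-- The height function of a chart-translate is the shifted height function. [folklore] -/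
theorem heightCurve_of_stereoCurve_add (hv : K'.stereoCurve = fun t ↦ K.stereoCurve t + v) (t : ℝ) :
    K'.heightCurve t = K.heightCurve t + v.2 := by
  have := congrFun hv t
  rw [Knot.heightCurve_eq_snd_comp, Function.comp_apply, this]
  rfl

/-- The velocity of the plane curve of a chart-translate is unchanged. [folklore] -/
theorem deriv_planeCurve_of_stereoCurve_add (hv : K'.stereoCurve = fun t ↦ K.stereoCurve t + v) (t : ℝ) :
    deriv K'.planeCurve t = deriv K.planeCurve t := by
  rw [show K'.planeCurve = fun s ↦ K.planeCurve s + v.1 from funext (planeCurve_of_stereoCurve_add hv)]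
  exact deriv_add_const v.1

/-- **Transport of a regular projection along a translation of the chart.** If the chart curve of
`K'` (stereographic chart from the north pole) is the translate by `v` of that of `K`, then `K'`
reads, with the same parameters, the same Gauss diagram as `K`: the plane curve is translated
(same double points, same velocities, same signs) and all heights are shifted by the same amount
(same over/under data). Rolfsen (1976), §3.E. [cite: Rolfsen1976, §3.E] -/
def translate (hK' : northPole ∉ range K') (hv : K'.stereoCurve = fun t ↦ K.stereoCurve t + v) :
    K'.RegularProjection where
  diagram := P.diagram
  θ := P.θ
  strictMono := P.strictMono
  lt_add_two_pi := P.lt_add_two_pi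
  northPole_notMem := hK'
  deriv_ne_zero t := by
    rw [deriv_planeCurve_of_stereoCurve_add hv]
    exact P.deriv_ne_zero t
  double i := by
    rw [planeCurve_of_stereoCurve_add hv, planeCurve_of_stereoCurve_add hv, P.double i]
  eq_or_crossing s t hst := by
    rw [planeCurve_of_stereoCurve_add hv, planeCurve_of_stereoCurve_add hv, add_left_inj] at hst
    exact P.eq_or_crossing s t hst
  heightCurve_lt i := by
    rw [heightCurve_of_stereoCurve_add hv, heightCurve_of_stereoCurve_add hv, add_lt_add_iff_right]
    exact P.heightCurve_lt i
  sign_eq i := by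
    rw [deriv_planeCurve_of_stereoCurve_add hv, deriv_planeCurve_of_stereoCurve_add hv]
    exact P.sign_eq i

/-- The translated projection reads the same diagram. [folklore] -/
@[simp] theorem translate_diagram (hK' : northPole ∉ range K')
    (hv : K'.stereoCurve = fun t ↦ K.stereoCurve t + v) : (P.translate hK' hv).diagram = P.diagram := rfl

/-- The translated projection has the same parameters. [folklore] -/
@[simp] theorem translate_θ (hK' : northPole ∉ range K')
    (hv : K'.stereoCurve = fun t ↦ K.stereoCurve t + v) : (P.translate hK' hv).θ = P.θ := rfl

end Translate

/-! ### Turning a knot over -/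

/-- The **turn-over map of the chart** `((a, y), h) ↦ ((a, -y), -h)`: the rotation by `π` about
the first axis of the projection plane. [folklore] -/
def flipChart (w : (ℝ × ℝ) × ℝ) : (ℝ × ℝ) × ℝ := ((w.1.1, -w.1.2), -w.2)

/-- The turn-over map of the chart is an involution. [folklore] -/
@[simp] theorem flipChart_flipChart (w : (ℝ × ℝ) × ℝ) : flipChart (flipChart w) = w := by
  simp [flipChart]

/-- The turn-over map of the chart is injective. [folklore] -/
theorem flipChart_injective : Injective flipChart := fun w w' h ↦ by
  rw [← flipChart_flipChart w, h, flipChart_flipChart]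

/-- The turn-over map as a continuous linear map. [folklore] -/
def flipChartL : ((ℝ × ℝ) × ℝ) →L[ℝ] ((ℝ × ℝ) × ℝ) :=
  ((ContinuousLinearMap.fst ℝ ℝ ℝ).comp (ContinuousLinearMap.fst ℝ (ℝ × ℝ) ℝ)).prod
      (-((ContinuousLinearMap.snd ℝ ℝ ℝ).comp (ContinuousLinearMap.fst ℝ (ℝ × ℝ) ℝ))) |>.prod
    (-(ContinuousLinearMap.snd ℝ (ℝ × ℝ) ℝ))

/-- The continuous linear turn-over map is `flipChart`. [folklore] -/
@[simp] theorem flipChartL_apply (w : (ℝ × ℝ) × ℝ) : flipChartL w = flipChart w := rfl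

section Flip

variable {K' : Knot}

/-- The plane curve of the turned-over knot is the reflected plane curve. [folklore] -/
theorem planeCurve_of_stereoCurve_flip (hf : K'.stereoCurve = fun t ↦ flipChart (K.stereoCurve t)) (t : ℝ) :
    K'.planeCurve t = ((K.planeCurve t).1, -(K.planeCurve t).2) := by
  have := congrFun hf t
  rw [Knot.planeCurve_eq_fst_comp, Function.comp_apply, this]
  rfl

/-- The height function of the turned-over knot is the negated height function. [folklore] -/
theorem heightCurve_of_stereoCurve_flip (hf : K'.stereoCurve = fun t ↦ flipChart (K.stereoCurve t)) (t : ℝ) :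
    K'.heightCurve t = -K.heightCurve t := by
  have := congrFun hf t
  rw [Knot.heightCurve_eq_snd_comp, Function.comp_apply, this]
  rfl

/-- The velocity of the reflected plane curve is the reflected velocity. [folklore] -/
theorem deriv_planeCurve_of_stereoCurve_flip (hK : northPole ∉ range K)
    (hf : K'.stereoCurve = fun t ↦ flipChart (K.stereoCurve t)) (t : ℝ) :
    deriv K'.planeCurve t = ((deriv K.planeCurve t).1, -(deriv K.planeCurve t).2) := by
  have hK₀ : ∀ x, K x ≠ northPole := fun x hx ↦ hK ⟨x, hx⟩
  have hd : HasDerivAt K.planeCurve (deriv K.planeCurve t) t :=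
    ((K.contDiff_planeCurve hK₀).differentiable (by simp) t).hasDerivAt
  -- the reflection of the plane as a continuous linear map
  set L : (ℝ × ℝ) →L[ℝ] (ℝ × ℝ) := (ContinuousLinearMap.fst ℝ ℝ ℝ).prod (-(ContinuousLinearMap.snd ℝ ℝ ℝ))
    with hL
  rw [show K'.planeCurve = L ∘ K.planeCurve from funext fun s ↦ by
    rw [planeCurve_of_stereoCurve_flip hf]; rfl]
  exact (L.hasFDerivAt.comp_hasDerivAt t hd).deriv

/-- **Transport of a regular projection to the turned-over knot.** If the chart curve of `K'` is
`((a, -y), -h)` where `((a, y), h)` is the chart curve of `K` (the knot rotated by `π` about the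
first axis of the projection plane), then `K'` reads, with the same parameters, the **flipped**
diagram `P.diagram.flip` (`GaussDiagram.flip`: every arrow reversed, signs and order kept): the
plane curve is reflected in the first axis (same double points), all heights are negated (over-
and under-passages exchanged), and the sign `sign det (γ'(over), γ'(under))` of every crossing is
kept — the reflection negates the determinant and so does the exchange of its two rows.
Rolfsen (1976), §3.E; GPV (2000), §1.4. [cite: GPV2000, §1.4] -/
def flip (hK' : northPole ∉ range K') (hf : K'.stereoCurve = fun t ↦ flipChart (K.stereoCurve t)) :
    K'.RegularProjection where
  diagram := P.diagram.flip
  θ := P.θ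
  strictMono := P.strictMono
  lt_add_two_pi := P.lt_add_two_pi
  northPole_notMem := hK'
  deriv_ne_zero t h := by
    apply P.deriv_ne_zero t
    rw [deriv_planeCurve_of_stereoCurve_flip P.northPole_notMem hf] at h
    have h1 := congrArg Prod.fst h
    have h2 := congrArg Prod.snd h
    simp only [Prod.fst_zero, Prod.snd_zero, neg_eq_zero] at h1 h2
    exact Prod.ext h1 h2
  double i := by
    show K'.planeCurve (P.θ (P.diagram.underPos i)) = K'.planeCurve (P.θ (P.diagram.overPos i))
    rw [planeCurve_of_stereoCurve_flip hf, planeCurve_of_stereoCurve_flip hf, P.double i]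
  eq_or_crossing s t hst := by
    have hst' : K.planeCurve s = K.planeCurve t := by
      rw [planeCurve_of_stereoCurve_flip hf, planeCurve_of_stereoCurve_flip hf] at hst
      have h1 := congrArg Prod.fst hst
      have h2 := congrArg Prod.snd hst
      simp only [neg_inj] at h1 h2
      exact Prod.ext h1 h2
    rcases P.eq_or_crossing s t hst' with h | ⟨i, k, l, h⟩
    · exact .inl h
    · refine .inr ⟨i, k, l, ?_⟩
      show ({s + k * (2 * π), t + l * (2 * π)} : Set ℝ) =
        {P.θ (P.diagram.underPos i), P.θ (P.diagram.overPos i)}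
      rw [h, Set.pair_comm]
  heightCurve_lt i := by
    show K'.heightCurve (P.θ (P.diagram.overPos i)) < K'.heightCurve (P.θ (P.diagram.underPos i))
    rw [heightCurve_of_stereoCurve_flip hf, heightCurve_of_stereoCurve_flip hf, neg_lt_neg_iff]
    exact P.heightCurve_lt i
  sign_eq i := by
    show ((P.diagram.sign i : ℤˣ) : ℤ) = SignType.sign (Matrix.det
      !![(deriv K'.planeCurve (P.θ (P.diagram.underPos i))).1,
          (deriv K'.planeCurve (P.θ (P.diagram.underPos i))).2;
         (deriv K'.planeCurve (P.θ (P.diagram.overPos i))).1,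
          (deriv K'.planeCurve (P.θ (P.diagram.overPos i))).2])
    rw [deriv_planeCurve_of_stereoCurve_flip P.northPole_notMem hf,
      deriv_planeCurve_of_stereoCurve_flip P.northPole_notMem hf, P.sign_eq i,
      Matrix.det_fin_two_of, Matrix.det_fin_two_of]
    ring_nf

/-- The turned-over projection reads the flipped diagram. [folklore] -/
@[simp] theorem flip_diagram (hK' : northPole ∉ range K')
    (hf : K'.stereoCurve = fun t ↦ flipChart (K.stereoCurve t)) : (P.flip hK' hf).diagram = P.diagram.flip := rfl

/-- The turned-over projection has the same parameters. [folklore] -/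
@[simp] theorem flip_θ (hK' : northPole ∉ range K')
    (hf : K'.stereoCurve = fun t ↦ flipChart (K.stereoCurve t)) : (P.flip hK' hf).θ = P.θ := rfl

end Flip

end RegularProjection

/-! ### Consequences for `HasGaussDiagram` and for Rasmussen's invariant of the diagrams read -/

/-- A knot with a regular projection reading `G` has, for every `j ≤ 2n`, one reading the rotated
diagram `G.rotate j`. GPV (2000), §1.2. [cite: GPV2000, §1.2] -/
theorem HasGaussDiagram.rotate {K : Knot} {G : GaussDiagram} (h : K.HasGaussDiagram G) (j : ℕ)
    (hj : j ≤ 2 * G.n) : K.HasGaussDiagram (G.rotate j) := by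
  obtain ⟨P, rfl⟩ := h
  exact ⟨P.rotate j hj, rfl⟩

/-- A chart-translate of a knot with a regular projection reading `G` reads `G`.
Rolfsen (1976), §3.E. [cite: Rolfsen1976, §3.E] -/
theorem HasGaussDiagram.translate {K K' : Knot} {G : GaussDiagram} (h : K.HasGaussDiagram G)
    (hK' : northPole ∉ range K') (v : (ℝ × ℝ) × ℝ) (hv : K'.stereoCurve = fun t ↦ K.stereoCurve t + v) :
    K'.HasGaussDiagram G := by
  obtain ⟨P, rfl⟩ := h
  exact ⟨P.translate hK' hv, rfl⟩

/-- The turned-over knot of a knot with a regular projection reading `G` reads `G.flip`.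
GPV (2000), §1.4. [cite: GPV2000, §1.4] -/
theorem HasGaussDiagram.flip {K K' : Knot} {G : GaussDiagram} (h : K.HasGaussDiagram G)
    (hK' : northPole ∉ range K') (hf : K'.stereoCurve = fun t ↦ RegularProjection.flipChart (K.stereoCurve t)) :
    K'.HasGaussDiagram G.flip := by
  obtain ⟨P, rfl⟩ := h
  exact ⟨P.flip hK' hf, rfl⟩

/-- The diagram read after a change of base point has the same Rasmussen invariant
(`rasmussenInvariant_rotate`). Rasmussen (2010), Def. 3.4. [cite: Rasmussen2010, Def. 3.4] -/
theorem RegularProjection.rasmussenInvariant_rotate_diagram {K : Knot} (P : K.RegularProjection) (j : ℕ)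
    (hj : j ≤ 2 * P.diagram.n) :
    (P.rotate j hj).diagram.rasmussenInvariant = P.diagram.rasmussenInvariant :=
  P.diagram.rasmussenInvariant_rotate j

/-- The diagram read by the turned-over knot has the same Rasmussen invariant
(`rasmussenInvariant_flip`). Rasmussen (2010), Def. 3.4. [cite: Rasmussen2010, Def. 3.4] -/
theorem RegularProjection.rasmussenInvariant_flip_diagram {K K' : Knot} (P : K.RegularProjection)
    (hK' : northPole ∉ range K') (hf : K'.stereoCurve = fun t ↦ RegularProjection.flipChart (K.stereoCurve t)) :
    (P.flip hK' hf).diagram.rasmussenInvariant = P.diagram.rasmussenInvariant :=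
  P.diagram.rasmussenInvariant_flip

end Knot

end Literature.Topology.FourManifolds
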